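import Summits.ValiantsHypothesis.ValiantsHypothesis.Theorems.SymPencilLagrangianKernel

/-!
# Route `SymPencil` — maximal-isotropic kernel rows with defect `≤ 1` force "affine + c·(linear)²"
# (core linear algebra of the rung `sdc(per_4) ≥ 19`, `--supports` stmt-ValiantsHypothesis-5674)

Same data and origin-moment hypotheses (i)–(iii) as `SymPencilLagrangianKernel.affine_of_lagrangian`,
but the Lagrangian hypothesis `2 dim (im b) = |ι'|` is weakened to the DEFECT-`≤ 1` hypothesis
`|ι'| ≤ 2 dim (im b) + 1` (the kernel rows are a maximal isotropic subspace of an odd-dimensional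
space, as happens for a symmetric representation of `per_4` of size `18`).  Conclusion
(`sq_of_isotropic_defect_le_one`): there is a constant `c` such that for every `u` there is a
linear functional `Λ` with

  `φ (u + s x) = e₀ + s e₁ + s² · c · Λ(x)²`      for all `x ∈ ker b` and all `s`.

Proof.  With `B := im b`, `B^⊥ ⊇ D⁻¹ B` has codimension `≤ 1` in it; the form `t ↦ tᵀ D t` on `B^⊥`
has `D⁻¹ B` in its radical, so it is `c₀ ℓ(t)²` for a functional `ℓ` vanishing on `D⁻¹B`; and the
`s²`-coefficient of (iii) at `z = u + s x` is `tᵀ D t` with `t = D⁻¹ C(x) D⁻¹ b(u) ∈ B^⊥`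
(first moment, polarised). [folklore]
-/

noncomputable section

-- single-conjunct layout: Sub = Summit, duplicated namespace component intended
set_option linter.dupNamespace false

namespace Summit.ValiantsHypothesis.ValiantsHypothesis.Theorems.SymPencilIsotropicKernelDefect

open Matrix
open Summit.ValiantsHypothesis.ValiantsHypothesis.Theorems.SymPencilLagrangianKernel

universe u

variable {k : Type u} [Field k] [CharZero k] {ι' : Type*} [Fintype ι'] [DecidableEq ι']
  {V : Type*} [AddCommGroup V] [Module k V]

/-- **Defect-`≤ 1` isotropic kernel rows force `φ (u + s x) = e₀ + s e₁ + s² c Λ(x)²` along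
`ker b`.**  See the module docstring. [folklore] -/
theorem sq_of_isotropic_defect_le_one {D : Matrix ι' ι' k} (hD : IsUnit D.det) (hDs : Dᵀ = D)
    (b : V →ₗ[k] (ι' → k)) (C : V →ₗ[k] Matrix ι' ι' k) (hCs : ∀ z, (C z)ᵀ = C z)
    (φ : V → k) {κ : k} (hκ : κ ≠ 0)
    (hi : ∀ z, b z ⬝ᵥ D⁻¹ *ᵥ b z = 0)
    (hii : ∀ z, b z ⬝ᵥ (D⁻¹ * C z * D⁻¹) *ᵥ b z = 0)
    (hiii : ∀ z, D.det * (b z ⬝ᵥ (D⁻¹ * C z * D⁻¹ * C z * D⁻¹) *ᵥ b z) = -(κ * φ z))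
    (hL : Fintype.card ι' ≤ 2 * Module.finrank k (LinearMap.range b) + 1) :
    ∃ c : k, ∀ u : V, ∃ Λ : V →ₗ[k] k, ∀ x : V, b x = 0 →
      ∃ e₀ e₁ : k, ∀ s : k, φ (u + s • x) = e₀ + s * e₁ + s ^ 2 * (c * (Λ x) ^ 2) := by
  classical
  have hDis : (D⁻¹)ᵀ = D⁻¹ := by rw [Matrix.transpose_nonsing_inv, hDs]
  set B := LinearMap.range b with hBdef
  -- (1) polarised isotropy on `B`
  have hsymm0 : ∀ y y' : ι' → k, y ⬝ᵥ D⁻¹ *ᵥ y' = y' ⬝ᵥ D⁻¹ *ᵥ y := fun y y' => by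
    rw [dotProduct_mulVec_of_transpose_eq hDis, dotProduct_comm]
  have hpol : ∀ y ∈ B, ∀ y' ∈ B, y ⬝ᵥ D⁻¹ *ᵥ y' = 0 := by
    rintro _ ⟨z, rfl⟩ _ ⟨z', rfl⟩
    have h := hi (z + z')
    rw [map_add, Matrix.mulVec_add, dotProduct_add, add_dotProduct, add_dotProduct, hi z, hi z',
      hsymm0 (b z') (b z), zero_add, add_zero, ← two_mul] at h
    exact (mul_eq_zero.1 h).resolve_left two_ne_zero
  -- (2) first moment along the kernel, polarised
  have hker1 : ∀ z v, b v = 0 → (D⁻¹ *ᵥ b z) ⬝ᵥ C v *ᵥ (D⁻¹ *ᵥ b z) = 0 := by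
    intro z v hv
    have h1 := hii (z + v)
    have h0 := hii z
    rw [map_add, hv, add_zero, map_add, sandwich₂_eq hDis, Matrix.add_mulVec, dotProduct_add] at h1
    rw [sandwich₂_eq hDis] at h0
    rwa [h0, zero_add] at h1
  have hsymm1 : ∀ v (p q : ι' → k), p ⬝ᵥ C v *ᵥ q = q ⬝ᵥ C v *ᵥ p := fun v p q => by
    rw [dotProduct_mulVec_of_transpose_eq (hCs v), dotProduct_comm]
  have hker2 : ∀ y ∈ B, ∀ y' ∈ B, ∀ v, b v = 0 → (D⁻¹ *ᵥ y) ⬝ᵥ C v *ᵥ (D⁻¹ *ᵥ y') = 0 := by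
    rintro _ ⟨z, rfl⟩ _ ⟨z', rfl⟩ v hv
    have h := hker1 (z + z') v hv
    rw [map_add, Matrix.mulVec_add, Matrix.mulVec_add, dotProduct_add, add_dotProduct,
      add_dotProduct, hker1 z v hv, hker1 z' v hv, hsymm1 v (D⁻¹ *ᵥ b z') (D⁻¹ *ᵥ b z), zero_add,
      add_zero, ← two_mul] at h
    exact (mul_eq_zero.1 h).resolve_left two_ne_zero
  -- (3) `B^⊥` as the kernel of the pairing with a basis of `B`, and `D⁻¹ B ≤ B^⊥`
  let yB := Module.finBasis k B
  set r := Module.finrank k B with hr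
  let Y : Matrix (Fin r) ι' k := Matrix.of fun i j => (yB i : ι' → k) j
  have hYrow : ∀ i, Y i = (yB i : ι' → k) := fun i => rfl
  let Bp : Submodule k (ι' → k) := LinearMap.ker Y.mulVecLin
  have memBp : ∀ t, t ∈ Bp ↔ ∀ y ∈ B, y ⬝ᵥ t = 0 := by
    intro t
    constructor
    · intro ht y hy
      rw [LinearMap.mem_ker, Matrix.mulVecLin_apply] at ht
      have hbas : ∀ i, (yB i : ι' → k) ⬝ᵥ t = 0 := fun i => by
        have := congr_fun ht i
        rwa [Matrix.mulVec, hYrow] at this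
      let φ' : B →ₗ[k] k :=
        { toFun := fun y => (y : ι' → k) ⬝ᵥ t
          map_add' := fun y₁ y₂ => by simp only [Submodule.coe_add, add_dotProduct]
          map_smul' := fun c y => by
            simp only [Submodule.coe_smul, smul_dotProduct, smul_eq_mul, RingHom.id_apply] }
      have hφ : φ' = 0 := yB.ext fun i => by rw [LinearMap.zero_apply]; exact hbas i
      have := LinearMap.congr_fun hφ ⟨y, hy⟩
      rwa [LinearMap.zero_apply] at this
    · intro ht
      rw [LinearMap.mem_ker, Matrix.mulVecLin_apply]
      ext i
      rw [Matrix.mulVec, hYrow, Pi.zero_apply]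
      exact ht _ (yB i).2
  let B' : Submodule k (ι' → k) := Submodule.map (D⁻¹).mulVecLin B
  have memB' : ∀ t, t ∈ B' ↔ ∃ y ∈ B, t = D⁻¹ *ᵥ y := fun t => by
    constructor
    · rintro ⟨y, hy, rfl⟩; exact ⟨y, hy, rfl⟩
    · rintro ⟨y, hy, rfl⟩; exact ⟨y, hy, rfl⟩
  have hB'le : B' ≤ Bp := by
    rintro _ ⟨y', hy', rfl⟩
    rw [memBp]
    intro y hy
    exact hpol _ hy _ hy'
  have hDiu : IsUnit D⁻¹ :=
    (Matrix.isUnit_iff_isUnit_det _).2 (Matrix.isUnit_nonsing_inv_det_iff.2 hD)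
  have hinj : Function.Injective (D⁻¹).mulVecLin := Matrix.mulVec_injective_iff_isUnit.2 hDiu
  have hB'dim : Module.finrank k B' = r := (Submodule.equivMapOfInjective _ hinj B).finrank_eq.symm
  have hYrank : Y.rank = r := by
    rw [Matrix.rank_eq_finrank_span_row]
    have hrange : Set.range Y.row = B.subtype '' Set.range yB := by
      ext q
      simp only [Set.mem_range, Set.mem_image, Submodule.coe_subtype, Matrix.row, hYrow]
      constructor
      · rintro ⟨i, rfl⟩; exact ⟨yB i, ⟨i, rfl⟩, rfl⟩
      · rintro ⟨_, ⟨i, rfl⟩, rfl⟩; exact ⟨i, rfl⟩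
    rw [hrange, Submodule.span_image, yB.span_eq, Submodule.map_top, Submodule.range_subtype]
  have hBpdim : Module.finrank k Bp ≤ r + 1 := by
    have h := LinearMap.finrank_range_add_finrank_ker Y.mulVecLin
    rw [Module.finrank_fintype_fun_eq_card] at h
    change Y.rank + Module.finrank k Bp = _ at h
    omega
  -- the quadratic form `t ↦ t ⬝ D t` on `B^⊥` is `c₀ ℓ(t)²`
  have hform : ∃ (c₀ : k) (ℓ : (ι' → k) →ₗ[k] k), ∀ t ∈ Bp, t ⬝ᵥ D *ᵥ t = c₀ * (ℓ t) ^ 2 := by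
    -- the radical contains `D⁻¹ B`
    have hrad : ∀ y ∈ B, ∀ t ∈ Bp, (D⁻¹ *ᵥ y) ⬝ᵥ D *ᵥ t = 0 := by
      intro y hy t ht
      rw [dotProduct_mulVec_of_transpose_eq hDs, Matrix.mulVec_mulVec, Matrix.mul_nonsing_inv _ hD,
        Matrix.one_mulVec]
      exact (memBp t).1 ht y hy
    by_cases hle : Bp ≤ B'
    · refine ⟨0, 0, fun t ht => ?_⟩
      obtain ⟨y, hy, rfl⟩ := (memB' t).1 (hle ht)
      rw [hrad y hy _ ht, zero_mul]
    · obtain ⟨t₀, ht₀, ht₀B⟩ := (SetLike.not_le_iff_exists.1 hle)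
      obtain ⟨f, hf0, hfB⟩ := Submodule.exists_dual_map_eq_bot_of_notMem ht₀B inferInstance
      rw [← LinearMap.le_ker_iff_map] at hfB
      set ℓ : (ι' → k) →ₗ[k] k := (f t₀)⁻¹ • f with hℓ
      have hℓt₀ : ℓ t₀ = 1 := by
        rw [hℓ, LinearMap.smul_apply, smul_eq_mul, inv_mul_cancel₀ hf0]
      have hℓB : ∀ d ∈ B', ℓ d = 0 := fun d hd => by
        have h := hfB hd
        rw [LinearMap.mem_ker] at h
        rw [hℓ, LinearMap.smul_apply, h, smul_zero]
      -- `Bp = B' ⊔ k ∙ t₀`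
      have hsup : B' ⊔ Submodule.span k {t₀} = Bp := by
        apply Submodule.eq_of_le_of_finrank_le
        · exact sup_le hB'le ((Submodule.span_singleton_le_iff_mem _ _).2 ht₀)
        · have hlt : B' < B' ⊔ Submodule.span k {t₀} := by
            refine lt_of_le_of_ne le_sup_left fun h => ht₀B ?_
            rw [h]
            exact Submodule.mem_sup_right (Submodule.mem_span_singleton_self t₀)
          have := Submodule.finrank_lt_finrank_of_lt hlt
          omega
      refine ⟨t₀ ⬝ᵥ D *ᵥ t₀, ℓ, fun t ht => ?_⟩
      rw [← hsup, Submodule.mem_sup] at ht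
      obtain ⟨d, hd, e, he, hde⟩ := ht
      obtain ⟨μ, rfl⟩ := Submodule.mem_span_singleton.1 he
      obtain ⟨y, hy, rfl⟩ := (memB' d).1 hd
      have hℓt : ℓ (D⁻¹ *ᵥ y + μ • t₀) = μ := by
        rw [map_add, map_smul, hℓB _ hd, hℓt₀, zero_add, smul_eq_mul, mul_one]
      rw [← hde, hℓt]
      have h1 : (D⁻¹ *ᵥ y) ⬝ᵥ D *ᵥ (D⁻¹ *ᵥ y) = 0 := hrad y hy _ (hB'le hd)
      have h2 : (D⁻¹ *ᵥ y) ⬝ᵥ D *ᵥ t₀ = 0 := hrad y hy t₀ ht₀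
      have h3 : t₀ ⬝ᵥ D *ᵥ (D⁻¹ *ᵥ y) = 0 := by
        rw [dotProduct_mulVec_of_transpose_eq hDs, dotProduct_comm]
        exact h2
      rw [Matrix.mulVec_add, Matrix.mulVec_smul, dotProduct_add, add_dotProduct, add_dotProduct,
        dotProduct_smul, smul_dotProduct, smul_dotProduct, dotProduct_smul, h1, h2, h3]
      simp only [smul_eq_mul, mul_zero, zero_add]
      ring
  obtain ⟨c₀, ℓ, hc₀⟩ := hform
  -- (4) the `s²`-coefficient: `w_x ⬝ D⁻¹ w_x = c₀ ℓ(D⁻¹ w_x)²` with `D⁻¹ w_x ∈ B^⊥`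
  have hIV : ∀ y ∈ B, ∀ v, b v = 0 →
      (C v *ᵥ (D⁻¹ *ᵥ y)) ⬝ᵥ D⁻¹ *ᵥ (C v *ᵥ (D⁻¹ *ᵥ y)) =
        c₀ * (ℓ (D⁻¹ *ᵥ (C v *ᵥ (D⁻¹ *ᵥ y)))) ^ 2 := by
    intro y hy v hv
    set w := C v *ᵥ (D⁻¹ *ᵥ y) with hw
    have ht : D⁻¹ *ᵥ w ∈ Bp := by
      rw [memBp]
      intro y' hy'
      rw [dotProduct_mulVec_of_transpose_eq hDis, hw, hsymm1]
      exact hker2 y hy y' hy' v hv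
    have h := hc₀ _ ht
    have hDw : D *ᵥ (D⁻¹ *ᵥ w) = w := by
      rw [Matrix.mulVec_mulVec, Matrix.mul_nonsing_inv _ hD, Matrix.one_mulVec]
    rw [hDw, dotProduct_comm] at h
    exact h
  -- (5) expand (iii) at `z = u + s x`
  refine ⟨-(D.det * c₀) / κ, fun u => ?_⟩
  set y := b u with hy
  have hyB : y ∈ B := ⟨u, rfl⟩
  set p := D⁻¹ *ᵥ y with hp
  let Λ : V →ₗ[k] k :=
    { toFun := fun x => ℓ (D⁻¹ *ᵥ (C x *ᵥ p))
      map_add' := fun x₁ x₂ => by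
        simp only [map_add, Matrix.add_mulVec, Matrix.mulVec_add]
      map_smul' := fun a x => by
        simp only [map_smul, Matrix.smul_mulVec, Matrix.mulVec_smul, smul_eq_mul,
          RingHom.id_apply] }
  have hΛ : ∀ x, Λ x = ℓ (D⁻¹ *ᵥ (C x *ᵥ p)) := fun x => rfl
  refine ⟨Λ, fun x hx => ?_⟩
  set wu := C u *ᵥ p with hwu
  set wx := C x *ᵥ p with hwx
  refine ⟨-(D.det * (wu ⬝ᵥ D⁻¹ *ᵥ wu)) / κ, -(D.det * (wu ⬝ᵥ D⁻¹ *ᵥ wx + wx ⬝ᵥ D⁻¹ *ᵥ wu)) / κ,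
    fun s => ?_⟩
  have h := hiii (u + s • x)
  have hbz : b (u + s • x) = y := by rw [map_add, map_smul, hx, smul_zero, add_zero]
  rw [hbz, sandwich_eq hDis (hCs _), map_add, map_smul, Matrix.add_mulVec, Matrix.smul_mulVec,
    ← hp, ← hwu, ← hwx, Matrix.mulVec_add, Matrix.mulVec_smul, dotProduct_add, add_dotProduct,
    add_dotProduct, dotProduct_smul, smul_dotProduct, smul_dotProduct, dotProduct_smul,
    hwx, hIV y hyB x hx, ← hp, ← hΛ] at h
  simp only [smul_eq_mul] at h
  field_simp
  linear_combination h

end Summit.ValiantsHypothesis.ValiantsHypothesis.Theorems.SymPencilIsotropicKernelDefect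

end
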